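import Summits.AtomisticToContinuum.HydrodynamicLimit.Theorems.InformationPercolationEngineChaosClosesEulerReductionResidual
import Summits.AtomisticToContinuum.HydrodynamicLimit.Theorems.InformationPercolationEngineChaosClosesEulerReductionShift
import Summits.AtomisticToContinuum.HydrodynamicLimit.Theorems.InformationPercolationEngineChaosClosesEulerReductionCollision
import Summits.AtomisticToContinuum.HydrodynamicLimit.Theorems.InformationPercolationEngineChaosClosesEulerReductionEvents
import Literature.Analysis.FluidPDE.NormalisedPressureDischarge
import HarnessLib

/-!
# Kinetic reduction (crux `ChaosClosesEuler`, stmt-AtomisticToContinuum-15141, line `Sketch`,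
# stub `stub_kineticReduction`) — helper: the momentum residual (H2) along one orbit, pathwise

WHAT. THE PATHWISE STEP OF (H2). Along ONE good orbit lying off the bad events, the momentum residual of the BF18
shell for the cone field `V = (ρ_r, m_r, e_r)` is bounded, uniformly in `τ ∈ [0, b]`, by the sum of: the weak stress
isotropy deviation `η_W` and half the collisional pressure deviation `η_P` at the grid time below `τ` (inputs at the
finitely many grid times `g b/n`); the possible collision at time `0` (`O(ε)`); the Hardy bond modulus `ω_x` of `∇ũ`
at scale `r + ε` times the total quadratic collision functional `Q_max`; the grid mesh `b/n` times the kinetic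
bounds of the stress and pressure profiles; the windowed quadratic collision functional `η_Q`; and the shift error
(`momentum_pathwise`). Ingredients: the decomposition `R^e = W + P + J` (helper `ReductionResidual`), the shift error
(helper `ReductionShift`), the jump functional against the stress functional and the quadratic functional (helper
`ReductionCollision`), and the identification of the pressure integrand with the route's `p_ex` under the cap.

No named fact is invoked.
-/

noncomputable section

namespace Summit.AtomisticToContinuum.HydrodynamicLimit.Theorems.ChaosClosesEulerReduction

open scoped BigOperators Topology Classical MeasureTheory ENNReal InnerProductSpace
open Filter Set MeasureTheory Function
open Literature.MathematicalPhysics.KineticTheory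
open Literature.Analysis.FluidPDE
open Literature.Analysis.FunctionSpaces
open Summit.AtomisticToContinuum.HydrodynamicLimit.Theorems.LocalSecondLawNegative
open Summit.AtomisticToContinuum.HydrodynamicLimit.Theorems.LocalSecondLawLedger
open Summit.AtomisticToContinuum.HydrodynamicLimit.Theorems.LocalSecondLawLedger.L (Mmom)

variable {N : ℕ}

/-! ## §1 Collision functionals agreeing on the window -/

/-- Two weights agreeing at every collision time of the window give the same collision functional. [folklore] -/
theorem collisionPairSum_congr_on {ε : ℝ} {γ : ℝ → Phase N} {S : Set ℝ}
    (hfin : (collisionTimes (Torus.geometry (Fin 3)) ε γ ∩ S).Finite) {g g' : ℝ → Fin (N + 1) → Fin (N + 1) → ℝ}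
    (h : ∀ t ∈ S, ∀ i j, g t i j = g' t i j) :
    collisionPairSum (Torus.geometry (Fin 3)) ε γ S g = collisionPairSum (Torus.geometry (Fin 3)) ε γ S g' := by
  rw [collisionPairSum_eq_finset_sum hfin, collisionPairSum_eq_finset_sum hfin]
  refine Finset.sum_congr rfl fun t ht => Finset.sum_congr rfl fun p _ => h t (hfin.mem_toFinset.1 ht).2 p.1 p.2

/-! ## §2 The registered sub-goal: real bookkeeping of the residual at a grid time -/

/-- **Registered sub-goal `stub_reductionMomentum` (helper of `stub_kineticReduction`): the bookkeeping of the
momentum residual at a grid time.** If `R = W + P + J`, `P = −(K₀ + K₁)/2 − err`, `|W| ≤ η_W`, `|err| ≤ η_P/2`,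
`|K₀|/2 ≤ z₀`, `|J − K₁/2| ≤ m`, then `|R| ≤ η_W + η_P/2 + z₀ + m`. [folklore] -/
theorem stub_reductionMomentum : ∀ {R W P J K₀ K₁ err ηW ηP z₀ m : ℝ}, R = W + P + J → P = -(K₀ + K₁) / 2 - err → |W| ≤ ηW → |err| ≤ ηP / 2 → |K₀| / 2 ≤ z₀ → |J - K₁ / 2| ≤ m → |R| ≤ ηW + ηP / 2 + z₀ + m := by
  intro R W P J K₀ K₁ err ηW ηP z₀ m hR hP hW herr hK₀ hm
  have e : R = W - err - K₀ / 2 + (J - K₁ / 2) := by rw [hR, hP]; ring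
  rw [e]
  have h1 := abs_add_le (W - err - K₀ / 2) (J - K₁ / 2)
  have h2 := abs_sub (W - err) (K₀ / 2)
  have h3 := abs_sub W err
  rw [abs_div, abs_two] at h2
  linarith

/-! ## §3 The pathwise step -/

set_option maxHeartbeats 1600000 in
/-- **THE PATHWISE STEP OF (H2).** See the module docstring. [folklore] -/
theorem momentum_pathwise {σ : ℝ} (hσ : 0 < σ) (hσ2 : σ < 2⁻¹)
    (Φ : HardSphereFlow (Torus.geometry (Fin 3)) (hsDiameter σ N) (N + 1))
    {z : Phase N} (hz : z ∈ Φ.good) {r : ℝ} (hr : 0 < r) (hr2 : r < 1 / 2)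
    {T : ℝ} {u : ℝ → T3 → V3} (hu : Torus.IsSmoothSpaceTimeOn (Ico 0 T) u) {e b : ℝ} (he : 0 < e) (hb : 0 ≤ b)
    (hbe : b + e < T) {χe : ℝ → ℝ} (hχ : ContinuousOn χe (Ioi 0)) {B : ℝ} (hB0 : 0 ≤ B) (hB : ∀ a, 0 < a → |χe a| ≤ B)
    {η₁ : ℝ} (hband : ∀ a, 0 < a → a * σ ^ 3 ≤ η₁ → χe a = hsCompressibility (a * σ ^ 3))
    (hcap : ∀ s ∈ Icc 0 b, ∀ x, rhoC r (Φ.flow s z) x * σ ^ 3 ≤ η₁)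
    {Cu : ℝ} (hCu : 0 ≤ Cu) (hut : ∀ s ∈ Icc 0 (b + e), ∀ x, ‖Torus.timeDerivWithin (Ico 0 T) u s x‖ ≤ Cu)
    (hD : ∀ s ∈ Icc 0 (b + e), ∀ x, ∀ i j : Fin 3, |Torus.partialDeriv j (fun y => u s y i) x| ≤ Cu)
    {ω : ℝ} (hω : 0 ≤ ω) (hωu : ∀ s ∈ Icc 0 b, ∀ x, ‖u (s + e) x - u s x‖ ≤ ω)
    (hωt : ∀ s ∈ Icc 0 b, ∀ x, ‖Torus.timeDerivWithin (Ico 0 T) u (s + e) x - Torus.timeDerivWithin (Ico 0 T) u s x‖ ≤ ω)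
    (hωD : ∀ s ∈ Icc 0 b, ∀ x, ∀ i j : Fin 3,
      |Torus.partialDeriv j (fun y => u (s + e) y i) x - Torus.partialDeriv j (fun y => u s y i) x| ≤ ω)
    {ωx : ℝ} (hωx0 : 0 ≤ ωx) (hωx : ∀ s ∈ Icc 0 b, ∀ x y : T3, Torus.euclidDist x y < r + hsDiameter σ N →
      ∀ i j : Fin 3, |Torus.partialDeriv j (fun y => u (s + e) y i) x - Torus.partialDeriv j (fun y' => u (s + e) y' i) y| ≤ ωx)
    {KE : ℝ} (hKE : ke z ≤ KE) {n : ℕ} (hn : 1 ≤ n) {ηW ηP ηQ Qmax : ℝ}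
    (hWg : ∀ g : Fin (n + 1), |∫ s in Icc 0 ((g : ℝ) * (b / n)), ∫ x, ∑ i : Fin 3, ∑ j : Fin 3,
      (Torus.partialDeriv j (fun y => u (s + e) y i) x -
        if i = j then (∑ k : Fin 3, Torus.partialDeriv k (fun y => u (s + e) y k) x) / 3 else 0) *
      (Mmom r (Φ.flow s z) x i j - momC r (Φ.flow s z) x i * momC r (Φ.flow s z) x j / rhoC r (Φ.flow s z) x)| ≤ ηW)
    (hPg : ∀ g : Fin (n + 1), |hsDiameter σ N / (N + 1 : ℝ) *
        collisionPairSum (Torus.geometry (Fin 3)) (hsDiameter σ N) (fun s => Φ.flow s z) (Icc 0 ((g : ℝ) * (b / n)))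
          (fun s i j => |⟪(vin (Φ.flow s z) i j).1 - (vin (Φ.flow s z) i j).2, nrm (hsDiameter σ N) (Φ.flow s z) i j⟫_ℝ| *
            ∑ k : Fin 3, ∑ l : Fin 3, (Torus.partialDeriv l (fun y => u (max 0 (min s b) + e) y k) (Φ.flow s z i).1 +
              Torus.partialDeriv k (fun y => u (max 0 (min s b) + e) y l) (Φ.flow s z i).1) / 2 *
              (nrm (hsDiameter σ N) (Φ.flow s z) i j k * nrm (hsDiameter σ N) (Φ.flow s z) i j l)) -
      2 * ∫ s in Icc 0 ((g : ℝ) * (b / n)), ∫ x,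
        (hsPressure σ (rhoC r (Φ.flow s z) x) (thetaC r (Φ.flow s z) x) - rhoC r (Φ.flow s z) x * thetaC r (Φ.flow s z) x) *
          ∑ k : Fin 3, (Torus.partialDeriv k (fun y => u (max 0 (min s b) + e) y k) x +
            Torus.partialDeriv k (fun y => u (max 0 (min s b) + e) y k) x) / 2| ≤ ηP)
    (hQg : ∀ g : Fin (n + 1), hsDiameter σ N / (N + 1 : ℝ) *
      collisionPairSum (Torus.geometry (Fin 3)) (hsDiameter σ N) (fun s => Φ.flow s z)
        (Ioc ((g : ℝ) * (b / n)) ((g : ℝ) * (b / n) + b / n)) (fun s i j => 1 + ‖(Φ.flow s z i).2‖ ^ 2 + ‖(Φ.flow s z j).2‖ ^ 2) ≤ ηQ)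
    (hQtot : hsDiameter σ N / (N + 1 : ℝ) *
      collisionPairSum (Torus.geometry (Fin 3)) (hsDiameter σ N) (fun s => Φ.flow s z) (Ioc 0 b)
        (fun s i j => 1 + ‖(Φ.flow s z i).2‖ ^ 2 + ‖(Φ.flow s z j).2‖ ^ 2) ≤ Qmax)
    {τ : ℝ} (hτ : τ ∈ Icc 0 b) :
    |((∫ x, ⟪u τ x, momC r (Φ.flow τ z) x⟫_ℝ) - (∫ x, ⟪u 0 x, momC r (Φ.flow 0 z) x⟫_ℝ) -
        ∫ s in Icc 0 τ, ∫ x, (⟪Torus.timeDerivWithin (Ico 0 T) u s x, momC r (Φ.flow s z) x⟫_ℝ +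
          ∑ i : Fin 3, ∑ j : Fin 3, Torus.partialDeriv j (fun y => u s y i) x *
            (momC r (Φ.flow s z) x i * momC r (Φ.flow s z) x j / rhoC r (Φ.flow s z) x +
              if i = j then rhoC r (Φ.flow s z) x * thetaC r (Φ.flow s z) x * χe (rhoC r (Φ.flow s z) x) else 0)))| ≤
      ηW + ηP / 2 + 3 / 2 * Cu * hsDiameter σ N * (2 * (N + 1 : ℝ)⁻¹ + 8 * KE) + 3 / 2 * ωx * Qmax +
        b / n * ((60 * Cu + 2 * Cu * (1 + B)) * KE) + 3 / 2 * Cu * ηQ +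
        ω * ((1 + 2 * KE) + b * ((7 + 2 * B) * KE + 1 / 2)) := by
  -- geometry, orbit, grid
  have hε : 0 < hsDiameter σ N := hsDiameter_pos hσ N
  have hG := Torus.isHardSphereRegular_geometry (d := Fin 3) ((hsDiameter_le hσ.le N).trans_lt hσ2)
  have hγ : IsHardSphereTrajectory (Torus.geometry (Fin 3)) (hsDiameter σ N) (N + 1) fun s => Φ.flow s z :=
    Φ.isTrajectory z hz
  have hke : ∀ s, ke (Φ.flow s z) = ke z := fun s => ke_flow_eq Φ hz s
  have hke0 : 0 ≤ ke z := ke_nonneg z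
  have hn0 : (0 : ℝ) < n := by exact_mod_cast hn
  have hN1 : (0 : ℝ) < (N + 1 : ℝ) := by positivity
  have hh0 : 0 ≤ b / n := div_nonneg hb hn0.le
  obtain ⟨g, hg1, hg2⟩ := exists_grid_index hb hn hτ
  have hτg0 : 0 ≤ (g : ℝ) * (b / n) := by positivity
  have hτg : (g : ℝ) * (b / n) ∈ Icc 0 b := ⟨hτg0, hg1.trans hτ.2⟩
  -- the shifted bounds on `[0, b]`
  have hsh : ∀ s ∈ Icc 0 b, s + e ∈ Icc 0 (b + e) := fun s hs => ⟨by linarith [hs.1, he.le], by linarith [hs.2]⟩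
  have hut' : ∀ s ∈ Icc 0 b, ∀ x, ‖Torus.timeDerivWithin (Ico 0 T) u (s + e) x‖ ≤ Cu := fun s hs x => hut _ (hsh s hs) x
  have hD' : ∀ s ∈ Icc 0 b, ∀ x, ∀ i j : Fin 3, |Torus.partialDeriv j (fun y => u (s + e) y i) x| ≤ Cu :=
    fun s hs x => hD _ (hsh s hs) x
  -- the decomposition at `τ` and at the grid time, the shift error
  obtain ⟨-, -, ⟨-, bW, pW, -⟩, ⟨iP, bP, pP, -⟩⟩ := residual_integrands Φ hz hr hr2 hu he.le hb hbe hχ hB0 hB hCu hut' hD'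
  beta_reduce at bW pW iP bP pP
  have hdecτ := residual_decomposition hσ hσ2 Φ hz hr hr2 hu he hb hbe hχ hB0 hB hCu hut' hD' hτ
  have hdecg := residual_decomposition hσ hσ2 Φ hz hr hr2 hu he hb hbe hχ hB0 hB hCu hut' hD' hτg
  have hshift' := shift_error Φ hz hr hr2 hu he.le hb hbe hχ hB0 hB hCu hut hD hω hωu hωt hωD hτ
  have hmono : (1 + 2 * ke z) + b * ((7 + 2 * B) * ke z + 1 / 2) ≤ (1 + 2 * KE) + b * ((7 + 2 * B) * KE + 1 / 2) := by
    nlinarith [hKE, hb, hB0, mul_nonneg hb hB0, mul_nonneg (mul_nonneg hb hB0) (sub_nonneg.2 hKE)]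
  have hshift := hshift'.trans (mul_le_mul_of_nonneg_left hmono hω)
  -- (1) the window pieces of `W` and `P` over `(τ_g, τ]`
  have hWsplit := setIntegral_Icc_split hτg0 hg1 (pW.mono_set (Icc_subset_Icc_right hτ.2))
  have hPsplit := setIntegral_Icc_split hτg0 hg1 (pP.mono_set (Icc_subset_Icc_right hτ.2))
  have hWwin := abs_setIntegral_Ioc_le hτg0 hg1 hτ.2 bW
  have hPwin := abs_setIntegral_Ioc_le hτg0 hg1 hτ.2 bP
  have hwin : (τ - (g : ℝ) * (b / n)) * (0 + 2 * Cu * 30 * ke z + 0) + (τ - (g : ℝ) * (b / n)) * (0 + 2 * Cu * (1 + B) * ke z + 0)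
      ≤ b / n * ((60 * Cu + 2 * Cu * (1 + B)) * KE) := by
    have h1 : τ - (g : ℝ) * (b / n) ≤ b / n := by linarith
    have h2 : 0 ≤ τ - (g : ℝ) * (b / n) := by linarith
    have h3 : (0 + 2 * Cu * 30 * ke z + 0) + (0 + 2 * Cu * (1 + B) * ke z + 0) ≤ (60 * Cu + 2 * Cu * (1 + B)) * KE := by
      nlinarith [mul_le_mul_of_nonneg_left hKE (by positivity : (0 : ℝ) ≤ 60 * Cu + 2 * Cu * (1 + B))]
    have h4 : 0 ≤ (0 + 2 * Cu * 30 * ke z + 0) + (0 + 2 * Cu * (1 + B) * ke z + 0) := by positivity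
    nlinarith
  -- (2) the collision functional: clamped velocity, windows
  set Gf : ℝ → Fin 3 → T3 → ℝ := fun s k x => u (max 0 (min s b) + e) x k with hGf
  have hcT : ∀ s, max 0 (min s b) + e ∈ Ico 0 T := fun s =>
    ⟨by linarith [(Literature.Analysis.FluidPDE.clamp_mem hb s).1, he.le], by linarith [(Literature.Analysis.FluidPDE.clamp_mem hb s).2]⟩
  have hGf1 : ∀ s k, Torus.IsContDiff 1 (Gf s k) := fun s k =>
    isContDiff_one_slice (isSmoothSpaceTimeOn_apply hu k) (hcT s)
  have hGfL : ∀ s k, ∃ K : NNReal, LipschitzWith K (Gf s k) := fun s k => L.exists_lipschitzWith_of_isContDiff (hGf1 s k)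
  have hGfM : ∀ s k l y, |pD l (Gf s k) y| ≤ Cu := fun s k l y => hD _ (hsh _ (Literature.Analysis.FluidPDE.clamp_mem hb s)) y k l
  -- the jump functional with the clamped velocity is the one of the decomposition on `(0, τ']`, `τ' ≤ b`
  have hJeq : ∀ {τ' : ℝ}, τ' ∈ Icc 0 b → ∀ (S : Set ℝ), S ⊆ Ioc 0 τ' →
      collisionPairSum (Torus.geometry (Fin 3)) (hsDiameter σ N) (fun s => Φ.flow s z) S
        (fun s i j => ∑ k : Fin 3, (∫ x, Gf s k x * cone r (Φ.flow s z i).1 x) * ((Φ.flow s z i).2 k - (vin (Φ.flow s z) i j).1 k)) =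
      collisionPairSum (Torus.geometry (Fin 3)) (hsDiameter σ N) (fun s => Φ.flow s z) S
        (fun s i j => ∑ k : Fin 3, (∫ x, u (s + e) x k * cone r (Φ.flow s z i).1 x) * ((Φ.flow s z i).2 k - (vin (Φ.flow s z) i j).1 k)) := by
    intro τ' hτ' S hS
    refine collisionPairSum_congr_on ((hγ.locFinite 0 τ').subset
      (Set.inter_subset_inter_right _ (hS.trans Ioc_subset_Icc_self))) fun t ht i j => ?_
    have htb : t ∈ Icc 0 b := ⟨(hS ht).1.le, (hS ht).2.trans hτ'.2⟩
    simp only [hGf, Literature.Analysis.FluidPDE.clamp_eq htb]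
  -- J over (0, τ] splits at τ_g
  have hfin0τ : (collisionTimes (Torus.geometry (Fin 3)) (hsDiameter σ N) (fun s => Φ.flow s z) ∩ Ioc 0 τ).Finite :=
    (hγ.locFinite 0 τ).subset (Set.inter_subset_inter_right _ Ioc_subset_Icc_self)
  have hJsplit : ∀ (gw : ℝ → Fin (N + 1) → Fin (N + 1) → ℝ),
      collisionPairSum (Torus.geometry (Fin 3)) (hsDiameter σ N) (fun s => Φ.flow s z) (Ioc 0 τ) gw =
      collisionPairSum (Torus.geometry (Fin 3)) (hsDiameter σ N) (fun s => Φ.flow s z) (Ioc 0 ((g : ℝ) * (b / n))) gw +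
      collisionPairSum (Torus.geometry (Fin 3)) (hsDiameter σ N) (fun s => Φ.flow s z) (Ioc ((g : ℝ) * (b / n)) τ) gw := by
    intro gw
    rw [← Ioc_union_Ioc_eq_Ioc hτg0 hg1]
    exact collisionPairSum_union (hfin0τ.subset (Set.inter_subset_inter_right _ (Ioc_subset_Ioc_right hg1)))
      (hfin0τ.subset (Set.inter_subset_inter_right _ (Ioc_subset_Ioc_left hτg0)))
      (Ioc_disjoint_Ioc_of_le le_rfl) gw
  -- |(N+1)⁻¹ J(τ_g, τ]| ≤ 3/2 Cu η_Q
  have hJwin := abs_jump_le_quad hε hγ hG hr hr2.le (S := Ioc ((g : ℝ) * (b / n)) τ) (a := 0) (b := b)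
    (Ioc_subset_Icc_self.trans (Icc_subset_Icc hτg0 hτ.2)) Gf hGfL hGfM
  rw [hJeq hτ _ (Ioc_subset_Ioc_left hτg0)] at hJwin
  have hQwin : hsDiameter σ N / (N + 1 : ℝ) * collisionPairSum (Torus.geometry (Fin 3)) (hsDiameter σ N) (fun s => Φ.flow s z)
      (Ioc ((g : ℝ) * (b / n)) τ) (fun s i j => 1 + ‖(Φ.flow s z i).2‖ ^ 2 + ‖(Φ.flow s z j).2‖ ^ 2) ≤ ηQ := by
    refine le_trans (mul_le_mul_of_nonneg_left (ChaosClosesEulerReadout.collisionPairSum_quad_mono hγ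
      (Ioc_subset_Ioc_right hg2) (a := 0) (b := b + b / n) (Ioc_subset_Icc_self.trans (Icc_subset_Icc hτg0 (by linarith [hτg.2]))))
      (div_nonneg hε.le hN1.le)) (hQg g)
  have hJwin' : |(N + 1 : ℝ)⁻¹ * collisionPairSum (Torus.geometry (Fin 3)) (hsDiameter σ N) (fun s => Φ.flow s z)
      (Ioc ((g : ℝ) * (b / n)) τ) (fun s i j => ∑ k : Fin 3, (∫ x, u (s + e) x k * cone r (Φ.flow s z i).1 x) *
        ((Φ.flow s z i).2 k - (vin (Φ.flow s z) i j).1 k))| ≤ 3 / 2 * Cu * ηQ :=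
    hJwin.trans (by
      have := mul_le_mul_of_nonneg_left hQwin (by positivity : (0 : ℝ) ≤ 3 / 2 * Cu)
      linarith)
  -- (3) at the grid time: J against K/2 through the bond modulus
  have hωB : ∀ s (p q : Fin (N + 1)), ‖(Torus.geometry (Fin 3)).sepVec (Φ.flow s z p).1 (Φ.flow s z q).1‖ = hsDiameter σ N →
      ∀ k l, |(∫ x, pD l (Gf s k) x * bondC r (Φ.flow s z) p q x) - (pD l (Gf s k) (Φ.flow s z p).1 + pD l (Gf s k) (Φ.flow s z q).1) / 2| ≤ ωx := by
    intro s p q hn k l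
    have hA : Continuous (pD l (Gf s k)) :=
      (continuousOn_partialDeriv_apply hu l k).comp_continuous (continuous_const.prodMk continuous_id)
        fun x => ⟨hcT s, mem_univ _⟩
    have hmod : ∀ x y : T3, Torus.euclidDist x y < r + hsDiameter σ N → |pD l (Gf s k) x - pD l (Gf s k) y| ≤ ωx :=
      fun x y hxy => hωx _ (Literature.Analysis.FluidPDE.clamp_mem hb s) x y hxy k l
    have h1 := abs_integral_mul_bondC_sub_le hr (Φ.flow s z) p q hr2.le hA (y := (Φ.flow s z p).1)
      (Or.inr (by rw [sepVec_eq_smul_nrm hε]; exact pos_eq_add_proj hε)) (fun x hx => hmod x _ (by rwa [hn] at hx))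
    have h2 := abs_integral_mul_bondC_sub_le hr (Φ.flow s z) p q hr2.le hA (y := (Φ.flow s z q).1)
      (Or.inl rfl) (fun x hx => hmod x _ (by rwa [hn] at hx))
    have e1 : (∫ x, pD l (Gf s k) x * bondC r (Φ.flow s z) p q x) - (pD l (Gf s k) (Φ.flow s z p).1 + pD l (Gf s k) (Φ.flow s z q).1) / 2 =
      (((∫ x, pD l (Gf s k) x * bondC r (Φ.flow s z) p q x) - pD l (Gf s k) (Φ.flow s z p).1) +
       ((∫ x, pD l (Gf s k) x * bondC r (Φ.flow s z) p q x) - pD l (Gf s k) (Φ.flow s z q).1)) / 2 := by ring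
    rw [e1, abs_div, abs_two]
    have := abs_add_le ((∫ x, pD l (Gf s k) x * bondC r (Φ.flow s z) p q x) - pD l (Gf s k) (Φ.flow s z p).1)
      ((∫ x, pD l (Gf s k) x * bondC r (Φ.flow s z) p q x) - pD l (Gf s k) (Φ.flow s z q).1)
    linarith
  have hJK := abs_jump_sub_half_stress_le_quad hε hγ hG hr (S := Ioc 0 ((g : ℝ) * (b / n))) (a := 0) (b := b)
    (Ioc_subset_Icc_self.trans (Icc_subset_Icc_right hτg.2)) Gf hGfL hωx0 hωB
  rw [hJeq hτg _ subset_rfl] at hJK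
  have hQg' : hsDiameter σ N / (N + 1 : ℝ) * collisionPairSum (Torus.geometry (Fin 3)) (hsDiameter σ N) (fun s => Φ.flow s z)
      (Ioc 0 ((g : ℝ) * (b / n))) (fun s i j => 1 + ‖(Φ.flow s z i).2‖ ^ 2 + ‖(Φ.flow s z j).2‖ ^ 2) ≤ Qmax :=
    le_trans (mul_le_mul_of_nonneg_left (ChaosClosesEulerReadout.collisionPairSum_quad_mono hγ
      (Ioc_subset_Ioc_right hτg.2) (a := 0) (b := b) Ioc_subset_Icc_self) (div_nonneg hε.le hN1.le)) hQtot
  have hJK' := hJK.trans (by nlinarith [hQg', hωx0] : 3 / 2 * ωx * (hsDiameter σ N / (N + 1 : ℝ) *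
      collisionPairSum (Torus.geometry (Fin 3)) (hsDiameter σ N) (fun s => Φ.flow s z) (Ioc 0 ((g : ℝ) * (b / n)))
        (fun s i j => 1 + ‖(Φ.flow s z i).2‖ ^ 2 + ‖(Φ.flow s z j).2‖ ^ 2)) ≤ 3 / 2 * ωx * Qmax)
  -- (4) at the grid time: the pressure integrand is `−(tr ∇ũ) p_ex` under the cap, and the CPV input
  have hK0 := abs_stress_time_zero_le hε hγ hG
    (fun k l (p : ℝ × T3) => (pD l (Gf p.1 k) p.2 + pD k (Gf p.1 l) p.2) / 2) hCu (fun k l p => by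
      have h1 := hGfM p.1 k l p.2
      have h2 := hGfM p.1 l k p.2
      rw [abs_div, abs_two]
      have := abs_add_le (pD l (Gf p.1 k) p.2) (pD k (Gf p.1 l) p.2)
      linarith)
  simp only at hK0
  rw [hke 0] at hK0
  have hK0' : hsDiameter σ N / (N + 1 : ℝ) * |collisionPairSum (Torus.geometry (Fin 3)) (hsDiameter σ N) (fun s => Φ.flow s z) {0}
      (fun s i j => |⟪(vin (Φ.flow s z) i j).1 - (vin (Φ.flow s z) i j).2, nrm (hsDiameter σ N) (Φ.flow s z) i j⟫_ℝ| *
        ∑ k : Fin 3, ∑ l : Fin 3, (pD l (Gf s k) (Φ.flow s z i).1 + pD k (Gf s l) (Φ.flow s z i).1) / 2 *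
          (nrm (hsDiameter σ N) (Φ.flow s z) i j k * nrm (hsDiameter σ N) (Φ.flow s z) i j l))| ≤
      3 * Cu * hsDiameter σ N * (2 * (N + 1 : ℝ)⁻¹ + 8 * KE) :=
    hK0.trans (by
      have := mul_le_mul_of_nonneg_left hKE (by positivity : (0 : ℝ) ≤ 3 * Cu * hsDiameter σ N * 8)
      nlinarith [this])
  -- the stress functional over [0, τ_g] splits as time-0 term plus (0, τ_g]
  have hKsplit := collisionPairSum_Icc_eq_zero_add_Ioc hγ hτg0
    (fun s i j => |⟪(vin (Φ.flow s z) i j).1 - (vin (Φ.flow s z) i j).2, nrm (hsDiameter σ N) (Φ.flow s z) i j⟫_ℝ| *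
      ∑ k : Fin 3, ∑ l : Fin 3, (pD l (Gf s k) (Φ.flow s z i).1 + pD k (Gf s l) (Φ.flow s z i).1) / 2 *
        (nrm (hsDiameter σ N) (Φ.flow s z) i j k * nrm (hsDiameter σ N) (Φ.flow s z) i j l))
  -- the pressure integrand under the cap
  have hpex : ∀ s ∈ Icc 0 ((g : ℝ) * (b / n)), ∀ x,
      (∑ k : Fin 3, Torus.partialDeriv k (fun y => u (s + e) y k) x) *
        (rhoC r (Φ.flow s z) x * thetaC r (Φ.flow s z) x -
          rhoC r (Φ.flow s z) x * thetaC r (Φ.flow s z) x * χe (rhoC r (Φ.flow s z) x)) =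
      -((hsPressure σ (rhoC r (Φ.flow s z) x) (thetaC r (Φ.flow s z) x) - rhoC r (Φ.flow s z) x * thetaC r (Φ.flow s z) x) *
        ∑ k : Fin 3, (Torus.partialDeriv k (fun y => u (max 0 (min s b) + e) y k) x +
          Torus.partialDeriv k (fun y => u (max 0 (min s b) + e) y k) x) / 2) := by
    intro s hs x
    have hsb : s ∈ Icc 0 b := ⟨hs.1, hs.2.trans hτg.2⟩
    rw [Literature.Analysis.FluidPDE.clamp_eq hsb, ← pV_eq_hsPressure (σ := σ) (fun hpos => hband _ hpos (hcap s hsb x)) hr]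
    have : ∑ k : Fin 3, (Torus.partialDeriv k (fun y => u (s + e) y k) x + Torus.partialDeriv k (fun y => u (s + e) y k) x) / 2 =
        ∑ k : Fin 3, Torus.partialDeriv k (fun y => u (s + e) y k) x := Finset.sum_congr rfl fun k _ => by ring
    rw [this]; ring
  have hPeq : (∫ s in Icc 0 ((g : ℝ) * (b / n)), ∫ x, (∑ k : Fin 3, Torus.partialDeriv k (fun y => u (s + e) y k) x) *
      (rhoC r (Φ.flow s z) x * thetaC r (Φ.flow s z) x -
        rhoC r (Φ.flow s z) x * thetaC r (Φ.flow s z) x * χe (rhoC r (Φ.flow s z) x))) =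
      -∫ s in Icc 0 ((g : ℝ) * (b / n)), ∫ x,
        (hsPressure σ (rhoC r (Φ.flow s z) x) (thetaC r (Φ.flow s z) x) - rhoC r (Φ.flow s z) x * thetaC r (Φ.flow s z) x) *
          ∑ k : Fin 3, (Torus.partialDeriv k (fun y => u (max 0 (min s b) + e) y k) x +
            Torus.partialDeriv k (fun y => u (max 0 (min s b) + e) y k) x) / 2 := by
    rw [← integral_neg]
    refine setIntegral_congr_fun measurableSet_Icc fun s hs => ?_
    rw [← integral_neg]
    exact integral_congr_ae (ae_of_all _ fun x => by beta_reduce; rw [hpex s hs x])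
  -- (5) bookkeeping at the grid time
  have hPg' := hPg g
  have hRg := stub_reductionMomentum (ηW := ηW) (ηP := ηP)
    (z₀ := 3 / 2 * Cu * hsDiameter σ N * (2 * (N + 1 : ℝ)⁻¹ + 8 * KE)) (m := 3 / 2 * ωx * Qmax) hdecg
    (K₀ := hsDiameter σ N / (N + 1 : ℝ) * collisionPairSum (Torus.geometry (Fin 3)) (hsDiameter σ N) (fun s => Φ.flow s z) {0}
      (fun s i j => |⟪(vin (Φ.flow s z) i j).1 - (vin (Φ.flow s z) i j).2, nrm (hsDiameter σ N) (Φ.flow s z) i j⟫_ℝ| *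
        ∑ k : Fin 3, ∑ l : Fin 3, (pD l (Gf s k) (Φ.flow s z i).1 + pD k (Gf s l) (Φ.flow s z i).1) / 2 *
          (nrm (hsDiameter σ N) (Φ.flow s z) i j k * nrm (hsDiameter σ N) (Φ.flow s z) i j l)))
    (K₁ := hsDiameter σ N / (N + 1 : ℝ) * collisionPairSum (Torus.geometry (Fin 3)) (hsDiameter σ N) (fun s => Φ.flow s z)
      (Ioc 0 ((g : ℝ) * (b / n)))
      (fun s i j => |⟪(vin (Φ.flow s z) i j).1 - (vin (Φ.flow s z) i j).2, nrm (hsDiameter σ N) (Φ.flow s z) i j⟫_ℝ| *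
        ∑ k : Fin 3, ∑ l : Fin 3, (pD l (Gf s k) (Φ.flow s z i).1 + pD k (Gf s l) (Φ.flow s z i).1) / 2 *
          (nrm (hsDiameter σ N) (Φ.flow s z) i j k * nrm (hsDiameter σ N) (Φ.flow s z) i j l)))
    (err := (∫ s in Icc 0 ((g : ℝ) * (b / n)), ∫ x,
        (hsPressure σ (rhoC r (Φ.flow s z) x) (thetaC r (Φ.flow s z) x) - rhoC r (Φ.flow s z) x * thetaC r (Φ.flow s z) x) *
          ∑ k : Fin 3, (Torus.partialDeriv k (fun y => u (max 0 (min s b) + e) y k) x +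
            Torus.partialDeriv k (fun y => u (max 0 (min s b) + e) y k) x) / 2) -
      (hsDiameter σ N / (N + 1 : ℝ) * collisionPairSum (Torus.geometry (Fin 3)) (hsDiameter σ N) (fun s => Φ.flow s z)
        (Icc 0 ((g : ℝ) * (b / n)))
        (fun s i j => |⟪(vin (Φ.flow s z) i j).1 - (vin (Φ.flow s z) i j).2, nrm (hsDiameter σ N) (Φ.flow s z) i j⟫_ℝ| *
          ∑ k : Fin 3, ∑ l : Fin 3, (pD l (Gf s k) (Φ.flow s z i).1 + pD k (Gf s l) (Φ.flow s z i).1) / 2 *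
            (nrm (hsDiameter σ N) (Φ.flow s z) i j k * nrm (hsDiameter σ N) (Φ.flow s z) i j l))) / 2)
    (by rw [hPeq, hKsplit]; ring) (hWg g) (by
      simp only [hGf] at hPg' ⊢
      rw [abs_sub_comm] at hPg'
      have e1 : ∀ {A K : ℝ}, A - K / 2 = (2 * A - K) / 2 := fun {A K} => by ring
      rw [e1, abs_div, abs_two]
      linarith [hPg']) (by
      rw [abs_mul, abs_of_nonneg (div_nonneg hε.le hN1.le)]
      linarith [hK0']) (by
      have e1 : ∀ {J K : ℝ}, J - K / 2 = J - 1 / 2 * K := fun {J K} => by ring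
      rw [e1]; exact hJK')
  -- (6) assemble: R(τ) = [R(τ) − R^e(τ)] + [R^e(τ) − R^e(τ_g)] + R^e(τ_g)
  have hdiff : ((∫ x, ⟪u (τ + e) x, momC r (Φ.flow τ z) x⟫_ℝ) - (∫ x, ⟪u (0 + e) x, momC r (Φ.flow 0 z) x⟫_ℝ) -
      ∫ s in Icc 0 τ, ∫ x, (⟪Torus.timeDerivWithin (Ico 0 T) u (s + e) x, momC r (Φ.flow s z) x⟫_ℝ +
        ∑ i : Fin 3, ∑ j : Fin 3, Torus.partialDeriv j (fun y => u (s + e) y i) x *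
          (momC r (Φ.flow s z) x i * momC r (Φ.flow s z) x j / rhoC r (Φ.flow s z) x +
            if i = j then rhoC r (Φ.flow s z) x * thetaC r (Φ.flow s z) x * χe (rhoC r (Φ.flow s z) x) else 0))) -
      (((∫ x, ⟪u ((g : ℝ) * (b / n) + e) x, momC r (Φ.flow ((g : ℝ) * (b / n)) z) x⟫_ℝ) -
        (∫ x, ⟪u (0 + e) x, momC r (Φ.flow 0 z) x⟫_ℝ) -
      ∫ s in Icc 0 ((g : ℝ) * (b / n)), ∫ x, (⟪Torus.timeDerivWithin (Ico 0 T) u (s + e) x, momC r (Φ.flow s z) x⟫_ℝ +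
        ∑ i : Fin 3, ∑ j : Fin 3, Torus.partialDeriv j (fun y => u (s + e) y i) x *
          (momC r (Φ.flow s z) x i * momC r (Φ.flow s z) x j / rhoC r (Φ.flow s z) x +
            if i = j then rhoC r (Φ.flow s z) x * thetaC r (Φ.flow s z) x * χe (rhoC r (Φ.flow s z) x) else 0)))) =
      (∫ s in Ioc ((g : ℝ) * (b / n)) τ, ∫ x, ∑ i : Fin 3, ∑ j : Fin 3, (Torus.partialDeriv j (fun y => u (s + e) y i) x -
          if i = j then (∑ k : Fin 3, Torus.partialDeriv k (fun y => u (s + e) y k) x) / 3 else 0) *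
        (Mmom r (Φ.flow s z) x i j - momC r (Φ.flow s z) x i * momC r (Φ.flow s z) x j / rhoC r (Φ.flow s z) x)) +
      (∫ s in Ioc ((g : ℝ) * (b / n)) τ, ∫ x, (∑ k : Fin 3, Torus.partialDeriv k (fun y => u (s + e) y k) x) *
        (rhoC r (Φ.flow s z) x * thetaC r (Φ.flow s z) x -
          rhoC r (Φ.flow s z) x * thetaC r (Φ.flow s z) x * χe (rhoC r (Φ.flow s z) x))) +
      (N + 1 : ℝ)⁻¹ * collisionPairSum (Torus.geometry (Fin 3)) (hsDiameter σ N) (fun s => Φ.flow s z)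
        (Ioc ((g : ℝ) * (b / n)) τ) (fun s i j => ∑ k : Fin 3, (∫ x, u (s + e) x k * cone r (Φ.flow s z i).1 x) *
          ((Φ.flow s z i).2 k - (vin (Φ.flow s z) i j).1 k)) := by
    rw [hdecτ, hdecg, hWsplit, hPsplit, hJsplit]; ring
  have key : ∀ {R Re Rg dW dP dJ : ℝ} {s1 s2 s3 s4 s5 : ℝ}, |R - Re| ≤ s1 → Re - Rg = dW + dP + dJ → |Rg| ≤ s2 →
      |dW| + |dP| ≤ s3 → |dJ| ≤ s4 → s5 = s1 + s2 + s3 + s4 → |R| ≤ s5 := by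
    intro R Re Rg dW dP dJ s1 s2 s3 s4 s5 h1 h2 h3 h4 h5 h6
    have e : R = (R - Re) + (dW + dP + dJ) + Rg := by rw [← h2]; ring
    rw [e, h6]
    have := abs_add_le ((R - Re) + (dW + dP + dJ)) Rg
    have := abs_add_le (R - Re) (dW + dP + dJ)
    have := abs_add_le (dW + dP) dJ
    have := abs_add_le dW dP
    linarith
  exact key hshift hdiff hRg (le_trans (add_le_add hWwin hPwin) hwin) hJwin' (by ring)

end Summit.AtomisticToContinuum.HydrodynamicLimit.Theorems.ChaosClosesEulerReduction

end
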